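import Summits.AtomisticToContinuum.HydrodynamicLimit.Theorems.RelayRaceLocalityRestartPrincipleReduction
import Summits.AtomisticToContinuum.HydrodynamicLimit.Theses.ResponseRigidity
import HarnessLib

/-!
# Crux idea `age-duhamel-forgetting` — first-lemma sketch (crux-ideate round 2, ideator 4)

Crux: stmt-AtomisticToContinuum-12503, `RelayRaceLocality.RestartPrinciple` (= `S → G`,
kernel-checked `RP ↔ (S ↔ G)`). Companion of `idea-age-duhamel-forgetting.md` in this folder.

Contents (everything over existing declarations; no skeleton is registered here):

* §1 THE DOCK (proved, sorry-free): the crux closes from the MEAN-MAP PROGRAMME —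
  `ResponseRigidity.MeanHydroLimitInBand` (shared stmt-AtomisticToContinuum-11927) and
  `ResponseRigidity.MeanClosure` (shared stmt-AtomisticToContinuum-11929) give the packing-guarded
  conjunct `GermanoSplitLES.HydroLimitInBand` (= the consequent `G`), hence `RestartPrinciple` by the
  landed `restartPrinciple_of_hydroLimitInBand` (p108006). `S` is idle, as the disprover showed it must be.
* §2 THE RESIDUE of the age-Duhamel line, typed in its first checkable (one-body, kinetic) form:
  `FastCurrentDecorrelation` — macroscopic-lag decay of the covariance between an extensive FAST
  one-body observable at birth and an extensive fast one-body observable at lag `r`, under the FRESH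
  local Gibbs law of the Euler profile (L² currency: both sums are `O(√N)`, the covariance is divided
  by `N + 1`, i.e. it is a correlation coefficient); `WeakRateConcentration` — fourth central moment of
  the `χ`-tested conserved fields at macroscopic flow time is `o(1/N)` under fresh local Gibbs data;
  `FastFieldVariance` — CLT-scale variance of the fast fields at all flow times (the dominating bound
  for dominated convergence of the age integral).
* §3 WHAT THE ROUTE'S CONE PROVES (typed): `OneKickMonopole` — the response of the TOTAL conserved
  content of the forward cone ball to one sphere's fast kick vanishes (conservation laws + two-copy
  light cone + Maxwellian orthogonality); false for free flight.

All three §2–§3 statements use the hypothesis frame of `ResponseRigidity.CLTScaleConcentration`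
(Euler activity family `a τ` with `a 0 = a₀`, mean-LLN of the fresh laws at every `τ`).
-/

noncomputable section

open Literature.MathematicalPhysics.KineticTheory Literature.Analysis.FluidPDE
open Literature.Analysis.FunctionSpaces MeasureTheory Filter Set Topology
open scoped RealInnerProductSpace
open Summit.AtomisticToContinuum.HydrodynamicLimit.Theses

namespace Summit.AtomisticToContinuum.HydrodynamicLimit.Cruxes.RestartPrinciple.AgeDuhamel

/-! ## §1 The dock (proved) -/

/-- Mean hydrodynamic limit in the band + entropy-saturated mean closure ⇒ the packing-guarded
conjunct `G` (consequent of the crux). Pure quantifier bookkeeping (`η₀ := min η₁ η₂`,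
`σ₀ := min σ₁ σ₂`). -/
theorem hydroLimitInBand_of_meanProgramme
    (hM : ResponseRigidity.MeanHydroLimitInBand) (hC : ResponseRigidity.MeanClosure) :
    GermanoSplitLES.HydroLimitInBand := by
  obtain ⟨η₁, hη₁, H₁⟩ := hM
  obtain ⟨η₂, hη₂, H₂⟩ := hC
  refine ⟨min η₁ η₂, lt_min hη₁ hη₂, ?_⟩
  intro a₀ θ₀ u₀ ha hθ hu ha0 hθ0
  obtain ⟨σ₁, hσ₁, G₁⟩ := H₁ a₀ θ₀ u₀ ha hθ hu ha0 hθ0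
  obtain ⟨σ₂, hσ₂, G₂⟩ := H₂ a₀ θ₀ u₀ ha hθ hu ha0 hθ0
  refine ⟨min σ₁ σ₂, lt_min hσ₁ hσ₂, ?_⟩
  intro σ hσ hσ' T ρ θ u hE hpack Φ h0 t ht
  have h1 : σ < σ₁ := lt_of_lt_of_le hσ' (min_le_left _ _)
  have h2 : σ < σ₂ := lt_of_lt_of_le hσ' (min_le_right _ _)
  have hp1 : ∀ s ∈ Set.Ico 0 T, ∀ x, ρ s x * σ ^ 3 < η₁ :=
    fun s hs x => lt_of_lt_of_le (hpack s hs x) (min_le_left _ _)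
  have hp2 : ∀ s ∈ Set.Ico 0 T, ∀ x, ρ s x * σ ^ 3 < η₂ :=
    fun s hs x => lt_of_lt_of_le (hpack s hs x) (min_le_right _ _)
  exact G₂ σ hσ h2 T ρ θ u hE hp2 Φ h0 t ht (G₁ σ hσ h1 T ρ θ u hE hp1 Φ h0 t ht)

/-- THE DOCK: the crux `RestartPrinciple` from the two shared mean-map items (11927, 11929), via the
landed one-liner `G → RestartPrinciple` (p108006). -/
theorem restartPrinciple_of_meanProgramme
    (hM : ResponseRigidity.MeanHydroLimitInBand) (hC : ResponseRigidity.MeanClosure) :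
    RelayRaceLocality.RestartPrinciple :=
  Theorems.RestartPrinciple.restartPrinciple_of_hydroLimitInBand
    (hydroLimitInBand_of_meanProgramme hM hC)

/-! ## §2 The residue of the age-Duhamel line (typed, not proved)

Notation inside the statements: `P τ N` is the FRESH local Gibbs law of the Euler profile at time `τ`
(activity `a τ`, velocity `u τ`, temperature `θ τ`); `c = (v − u_τ'(x))/√θ_τ'(x)` the peculiar
velocity in local thermal units at the relevant time `τ'`; a velocity test `g : V3 → ℝ` is FAST when it
is bounded and orthogonal to the five collision invariants under the standard Maxwellian
`globalMaxwellian = localMaxwellian 1 1 0`.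
-/

/-- A bounded velocity test function orthogonal to `1, v, |v|²` under the standard Maxwellian: the
"fast" (non-hydrodynamic) one-body directions, e.g. the traceless kinetic stress `c₁c₂` or the heat
flux `c(|c|² − 5)/2`. -/
def IsFastTest (g : V3 → ℝ) : Prop :=
  Measurable g ∧ (∃ C : ℝ, ∀ v, |g v| ≤ C) ∧
    (∫ v, g v * globalMaxwellian v = 0) ∧
    (∀ j : Fin 3, ∫ v, g v * v j * globalMaxwellian v = 0) ∧
    (∫ v, g v * ‖v‖ ^ 2 * globalMaxwellian v = 0)

/-- The extensive fast one-body observable `Σ_i φ(x_i) g((v_i − w(x_i))/√ϑ(x_i))` of a configuration,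
read in the local thermal units of the profile `(w, ϑ)`. -/
def fastSum {n : ℕ} (φ : T3 → ℝ) (g : V3 → ℝ) (w : T3 → V3) (ϑ : T3 → ℝ)
    (z : Config n (Fin 3) T3) : ℝ :=
  ∑ i, φ (z i).1 * g ((Real.sqrt (ϑ (z i).1))⁻¹ • ((z i).2 - w (z i).1))

/-- RESIDUE 1 (the bet, L² currency): MACROSCOPIC-LAG DECORRELATION OF FAST OBSERVABLES UNDER FRESH
LOCAL GIBBS LAWS. Along every packing-guarded classical solution and every Euler activity family, for
fast tests `g, g'`, smooth weights `φ, χ`, every birth time `τ` and every FIXED macroscopic lag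
`r > 0` with `τ + r ≤ t < T`: the covariance under the fresh law `P τ N` between the fast sum at flow
time `0` (thermal units of the profile at `τ`) and the fast sum at flow time `r` (thermal units of the
profile at `τ + r`), divided by `N + 1`, tends to `0`. Both sums are centred `O(√N)` fluctuations, so
this says their correlation coefficient vanishes: the birth defect of the age-Duhamel identity is not
re-read by any fast current at positive macroscopic lag. Equilibrium instance = decay, at `N^{1/3}`
kinetic times, of the total current–current correlation minus its Drude part (Spohn 1991 (7.45));
false for free flight (no decay) and for 1-D hard rods (extra conservation laws, Mazur). -/
def FastCurrentDecorrelation : Prop :=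
  ∃ η : ℝ, 0 < η ∧ ∀ (a₀ θ₀ : T3 → ℝ) (u₀ : T3 → V3), Continuous a₀ → Continuous θ₀ →
    Continuous u₀ → (∀ x, 0 < a₀ x) → (∀ x, 0 < θ₀ x) → ∃ σ₀ : ℝ, 0 < σ₀ ∧ ∀ σ : ℝ, 0 < σ →
    σ < σ₀ → ∀ (T : ℝ) (ρ θ : ℝ → T3 → ℝ) (u : ℝ → T3 → V3), IsHardSphereEulerSolution σ T ρ u θ →
    (∀ t ∈ Set.Ico 0 T, ∀ x, ρ t x * σ ^ 3 < η) →
    ∀ Φ : (N : ℕ) → HardSphereFlow (Torus.geometry (Fin 3)) (hsDiameter σ N) (N + 1),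
    TendstoHydroFieldsAt (fun N => localGibbsLaw σ a₀ u₀ θ₀ N (Φ N)) Φ ρ u θ 0 →
    ∀ a : ℝ → T3 → ℝ, a 0 = a₀ → (∀ τ ∈ Set.Ico 0 T, Continuous (a τ) ∧ ∀ x, 0 < a τ x) →
    (∀ τ ∈ Set.Ico 0 T, ∀ χ : T3 → ℝ, Torus.IsSmooth χ →
      Tendsto (fun N : ℕ => ∫ z, empiricalDensityField z χ
        ∂(localGibbsLaw σ (a τ) (u τ) (θ τ) N (Φ N))) atTop (𝓝 (∫ x, χ x * ρ τ x)) ∧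
      (∀ j : Fin 3, Tendsto (fun N : ℕ => ∫ z, empiricalMomentumField z χ j
        ∂(localGibbsLaw σ (a τ) (u τ) (θ τ) N (Φ N))) atTop (𝓝 (∫ x, χ x * ρ τ x * u τ x j))) ∧
      Tendsto (fun N : ℕ => ∫ z, empiricalEnergyField z χ
        ∂(localGibbsLaw σ (a τ) (u τ) (θ τ) N (Φ N))) atTop
        (𝓝 (∫ x, χ x * totalEnergyDensity (ρ τ x) (u τ x) (θ τ x)))) →
    ∀ t ∈ Set.Ico 0 T, ∀ (φ χ : T3 → ℝ), Torus.IsSmooth φ → Torus.IsSmooth χ →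
    ∀ (g g' : V3 → ℝ), IsFastTest g → IsFastTest g' →
    ∀ τ r : ℝ, 0 ≤ τ → 0 < r → τ + r ≤ t →
    Tendsto (fun N : ℕ =>
      let P : Measure (Config (N + 1) (Fin 3) T3) := localGibbsLaw σ (a τ) (u τ) (θ τ) N (Φ N)
      let A : Config (N + 1) (Fin 3) T3 → ℝ := fun z => fastSum φ g (u τ) (θ τ) z
      let B : Config (N + 1) (Fin 3) T3 → ℝ :=
        fun z => fastSum χ g' (u (τ + r)) (θ (τ + r)) ((Φ N).flow r z)
      ((N : ℝ) + 1)⁻¹ * ((∫ z, A z * B z ∂P) - (∫ z, A z ∂P) * ∫ z, B z ∂P)) atTop (𝓝 0)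

/-- RESIDUE 2 (weak-rate concentration, L⁴ currency — physically `(N+1)·E|δU|⁴ ≍ 1/N`): along every
Euler activity family the fourth central moment of each `χ`-tested conserved field at macroscopic
flow time `s`, under the fresh law born at `τ` (`s + τ ≤ t < T`), is `o(1/(N+1))`. It is what the
age-Duhamel identity pays for the quadratic (non-linear-flux) remainder: `‖W‖₂ ≍ √N` against
`‖δU²‖₂ = ‖δU‖₄²`. At `s = 0` and at constant profiles it is a static cumulant bound. Compare
`ResponseRigidity.CLTScaleConcentration` (variance `≤ C/(N+1)`). -/
def WeakRateConcentration : Prop :=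
  ∃ η : ℝ, 0 < η ∧ ∀ (a₀ θ₀ : T3 → ℝ) (u₀ : T3 → V3), Continuous a₀ → Continuous θ₀ →
    Continuous u₀ → (∀ x, 0 < a₀ x) → (∀ x, 0 < θ₀ x) → ∃ σ₀ : ℝ, 0 < σ₀ ∧ ∀ σ : ℝ, 0 < σ →
    σ < σ₀ → ∀ (T : ℝ) (ρ θ : ℝ → T3 → ℝ) (u : ℝ → T3 → V3), IsHardSphereEulerSolution σ T ρ u θ →
    (∀ t ∈ Set.Ico 0 T, ∀ x, ρ t x * σ ^ 3 < η) →
    ∀ Φ : (N : ℕ) → HardSphereFlow (Torus.geometry (Fin 3)) (hsDiameter σ N) (N + 1),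
    TendstoHydroFieldsAt (fun N => localGibbsLaw σ a₀ u₀ θ₀ N (Φ N)) Φ ρ u θ 0 →
    ∀ a : ℝ → T3 → ℝ, a 0 = a₀ → (∀ τ ∈ Set.Ico 0 T, Continuous (a τ) ∧ ∀ x, 0 < a τ x) →
    (∀ τ ∈ Set.Ico 0 T, ∀ χ : T3 → ℝ, Torus.IsSmooth χ →
      Tendsto (fun N : ℕ => ∫ z, empiricalDensityField z χ
        ∂(localGibbsLaw σ (a τ) (u τ) (θ τ) N (Φ N))) atTop (𝓝 (∫ x, χ x * ρ τ x)) ∧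
      (∀ j : Fin 3, Tendsto (fun N : ℕ => ∫ z, empiricalMomentumField z χ j
        ∂(localGibbsLaw σ (a τ) (u τ) (θ τ) N (Φ N))) atTop (𝓝 (∫ x, χ x * ρ τ x * u τ x j))) ∧
      Tendsto (fun N : ℕ => ∫ z, empiricalEnergyField z χ
        ∂(localGibbsLaw σ (a τ) (u τ) (θ τ) N (Φ N))) atTop
        (𝓝 (∫ x, χ x * totalEnergyDensity (ρ τ x) (u τ x) (θ τ x)))) →
    ∀ t ∈ Set.Ico 0 T, ∀ χ : T3 → ℝ, Torus.IsSmooth χ →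
    ∀ s τ : ℝ, 0 ≤ s → 0 ≤ τ → s + τ ≤ t →
    ∀ F : (N : ℕ) → Config (N + 1) (Fin 3) T3 → ℝ,
    ((F = fun N z => empiricalDensityField ((Φ N).flow s z) χ) ∨
      (∃ j : Fin 3, F = fun N z => empiricalMomentumField ((Φ N).flow s z) χ j) ∨
      F = fun N z => empiricalEnergyField ((Φ N).flow s z) χ) →
    Tendsto (fun N : ℕ =>
      let P : Measure (Config (N + 1) (Fin 3) T3) := localGibbsLaw σ (a τ) (u τ) (θ τ) N (Φ N)
      ((N : ℝ) + 1) * ∫ z, (F N z - ∫ w, F N w ∂P) ^ 4 ∂P) atTop (𝓝 0)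

/-- RESIDUE 3 (CLT-scale variance of FAST fields at all flow times — the dominating bound that makes
the age-integral of the birth covariance converge by dominated convergence; the cone gives it for free
below lag `o(N^{-1/5})` by the disjoint-backward-cone count, statics give it at lag `0`): along every
Euler activity family, for a fast test `g'` and a smooth weight `χ`, the variance under the fresh law
born at `τ` of the extensive fast sum at flow time `s` (`s + τ ≤ t < T`), read in the thermal units of
the profile at `τ + s`, is `≤ C·(N+1)` with `C` independent of `N, s, τ`. Compare
`ResponseRigidity.CLTScaleConcentration` (the same bound for the CONSERVED fields). -/
def FastFieldVariance : Prop :=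
  ∃ η : ℝ, 0 < η ∧ ∀ (a₀ θ₀ : T3 → ℝ) (u₀ : T3 → V3), Continuous a₀ → Continuous θ₀ →
    Continuous u₀ → (∀ x, 0 < a₀ x) → (∀ x, 0 < θ₀ x) → ∃ σ₀ : ℝ, 0 < σ₀ ∧ ∀ σ : ℝ, 0 < σ →
    σ < σ₀ → ∀ (T : ℝ) (ρ θ : ℝ → T3 → ℝ) (u : ℝ → T3 → V3), IsHardSphereEulerSolution σ T ρ u θ →
    (∀ t ∈ Set.Ico 0 T, ∀ x, ρ t x * σ ^ 3 < η) →
    ∀ Φ : (N : ℕ) → HardSphereFlow (Torus.geometry (Fin 3)) (hsDiameter σ N) (N + 1),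
    TendstoHydroFieldsAt (fun N => localGibbsLaw σ a₀ u₀ θ₀ N (Φ N)) Φ ρ u θ 0 →
    ∀ a : ℝ → T3 → ℝ, a 0 = a₀ → (∀ τ ∈ Set.Ico 0 T, Continuous (a τ) ∧ ∀ x, 0 < a τ x) →
    (∀ τ ∈ Set.Ico 0 T, ∀ χ : T3 → ℝ, Torus.IsSmooth χ →
      Tendsto (fun N : ℕ => ∫ z, empiricalDensityField z χ
        ∂(localGibbsLaw σ (a τ) (u τ) (θ τ) N (Φ N))) atTop (𝓝 (∫ x, χ x * ρ τ x)) ∧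
      (∀ j : Fin 3, Tendsto (fun N : ℕ => ∫ z, empiricalMomentumField z χ j
        ∂(localGibbsLaw σ (a τ) (u τ) (θ τ) N (Φ N))) atTop (𝓝 (∫ x, χ x * ρ τ x * u τ x j))) ∧
      Tendsto (fun N : ℕ => ∫ z, empiricalEnergyField z χ
        ∂(localGibbsLaw σ (a τ) (u τ) (θ τ) N (Φ N))) atTop
        (𝓝 (∫ x, χ x * totalEnergyDensity (ρ τ x) (u τ x) (θ τ x)))) →
    ∀ t ∈ Set.Ico 0 T, ∀ χ : T3 → ℝ, Torus.IsSmooth χ → ∀ g' : V3 → ℝ, IsFastTest g' →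
    ∃ C : ℝ, ∀ N : ℕ, ∀ s τ : ℝ, 0 ≤ s → 0 ≤ τ → s + τ ≤ t →
      let P : Measure (Config (N + 1) (Fin 3) T3) := localGibbsLaw σ (a τ) (u τ) (θ τ) N (Φ N)
      let B : Config (N + 1) (Fin 3) T3 → ℝ :=
        fun z => fastSum χ g' (u (τ + s)) (θ (τ + s)) ((Φ N).flow s z)
      Integrable (fun z => (B z - ∫ w, B w ∂P) ^ 2) P ∧
        ∫ z, (B z - ∫ w, B w ∂P) ^ 2 ∂P ≤ C * ((N : ℝ) + 1)

/-! ## §3 What the route's light cone proves (typed, not proved) -/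

/-- THE CONE'S CONTRIBUTION (monopole of the one-kick response vanishes): along every Euler activity
family there is a cone speed `c` such that, for a fast test `g`, a smooth weight `φ`, a lag `r` and a
radius `R > c·r`, the covariance under the fresh law between ONE sphere's fast variable
`φ(x₀) g(c₀)` at flow time `0` and the TOTAL mass / momentum / energy found at flow time `r` inside
the ball `B(x₀(0), R)` tends to `0`. Mechanism: resample `v₀` from its conditional Maxwellian (exact
invariance of the fresh law); by the two-copy light cone the two evolutions differ only inside
`B(x₀(0), c r)`, so by the conservation laws the ball's content differs exactly by sphere `0`'s own
invariants, against which `g` is orthogonal. False for free flight (sphere `0` leaves the ball with a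
`g`-correlated probability). This is the `k = 0` (locally constant test function) part of
`ResponseRigidity.HydrodynamicSufficiency`, and the one instance of `RelayRaceLocality.LightConeInLaw`'s
mechanism whose disagreement set is a single sphere. -/
def OneKickMonopole : Prop :=
  ∃ η : ℝ, 0 < η ∧ ∀ (a₀ θ₀ : T3 → ℝ) (u₀ : T3 → V3), Continuous a₀ → Continuous θ₀ →
    Continuous u₀ → (∀ x, 0 < a₀ x) → (∀ x, 0 < θ₀ x) → ∃ σ₀ : ℝ, 0 < σ₀ ∧ ∀ σ : ℝ, 0 < σ →
    σ < σ₀ → ∀ (T : ℝ) (ρ θ : ℝ → T3 → ℝ) (u : ℝ → T3 → V3), IsHardSphereEulerSolution σ T ρ u θ →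
    (∀ t ∈ Set.Ico 0 T, ∀ x, ρ t x * σ ^ 3 < η) →
    ∀ Φ : (N : ℕ) → HardSphereFlow (Torus.geometry (Fin 3)) (hsDiameter σ N) (N + 1),
    TendstoHydroFieldsAt (fun N => localGibbsLaw σ a₀ u₀ θ₀ N (Φ N)) Φ ρ u θ 0 →
    ∀ a : ℝ → T3 → ℝ, a 0 = a₀ → (∀ τ ∈ Set.Ico 0 T, Continuous (a τ) ∧ ∀ x, 0 < a τ x) →
    ∀ M : ℝ, 0 < M → ∃ c : ℝ, 0 < c ∧
    ∀ t ∈ Set.Ico 0 T, (∀ s ∈ Set.Icc 0 t, ∀ x, θ s x ≤ M ∧ ‖u s x‖ ≤ M) →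
    ∀ φ : T3 → ℝ, Torus.IsSmooth φ → ∀ g : V3 → ℝ, IsFastTest g →
    ∀ τ r R : ℝ, 0 ≤ τ → 0 < r → τ + r ≤ t → c * r < R →
    ∀ e : V3 → ℝ, (e = fun _ => 1) ∨ (∃ j : Fin 3, e = fun v => v j) ∨ (e = fun v => ‖v‖ ^ 2 / 2) →
    Tendsto (fun N : ℕ =>
      let P : Measure (Config (N + 1) (Fin 3) T3) := localGibbsLaw σ (a τ) (u τ) (θ τ) N (Φ N)
      let w : Config (N + 1) (Fin 3) T3 → ℝ :=
        fun z => φ (z 0).1 * g ((Real.sqrt (θ τ (z 0).1))⁻¹ • ((z 0).2 - u τ (z 0).1))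
      let Q : Config (N + 1) (Fin 3) T3 → ℝ := fun z =>
        ∑ j, (if Torus.euclidDist ((Φ N).flow r z j).1 (z 0).1 < R then e ((Φ N).flow r z j).2
          else 0)
      (∫ z, w z * Q z ∂P) - (∫ z, w z ∂P) * ∫ z, Q z ∂P) atTop (𝓝 0)

end Summit.AtomisticToContinuum.HydrodynamicLimit.Cruxes.RestartPrinciple.AgeDuhamel

end
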